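import Summits.Ventures.YMGap.FlowData.OstrowskiWeylRecord

/-!
# Venture YMGap, track Y3 FLOW-DATA — lineage A-onesite / A-t211's block enclosure of record
# (engine-1's `linalg.certify`, the «index-wise Ostrowski–Weyl certificate») is an index-wise enclosure

HONEST FRAMING: venture file of the cell `pub-ymgap` (QuantumFields programme), track Y3.  ONE floating-point routine,
`engine/onesite/linalg.py: certify(B, lam, X, E_fro)` (engine-1 g5, 2026-08-22), certifies every symmetry block of every
row of the one-site lineage A («A-onesite»: engine-1's 1² (d = 3) and 1³ (d = 4) rows `onesite3q`; engine-4's 1³ precision,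
plaquette and 't Hooft-twisted rows `kit3qa` / `kit3qtw`) and of engine-4's d = 4 tube lineage «A-t211» (2×1×1 × ∞,
`t211_build.certify_sectors`) — the file `linalg.py` is byte-identical in all four bundles.  From a floating-point
eigendecomposition `(X, L)` of the assembled real symmetric block `B` it prints, for EVERY index `i`,

  `λᵢ(B*) ∈ [ lo_s/(1+α) if lo_s ≥ 0 else lo_s/(1−α)  −  E_F ,  hi_s/(1−α) if hi_s ≥ 0 else hi_s/(1+α)  +  E_F ]`,
  `lo_s = lᵢ − ρ`, `hi_s = lᵢ + ρ`, `ρ = α·Lmax + √(1+α)·δ`, `Lmax = max |L|`,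

where `B*` is the exact block (`‖B* − B‖_F ≤ E_F`, the a-priori assembly bound), `α ≥ ‖Xᵀ X − I‖₂` and `δ ≥ ‖B X − X·diag L‖₂`
are certified THROUGH FROBENIUS MAJORANTS (`‖fl(XᵀX) − I‖_F (1+10⁻⁶) + γ_n ‖X‖_F²`, resp. `‖fl(BX − XΛ)‖_F (1+10⁻⁶) + …`), the
routine REFUSES `α ≥ 1/2` (`raise RuntimeError`), and it finally widens both ends outward by `8u·|·|` and a factor `1+10⁻⁶`
(rounding of its own four float operations).  The «by sign» branches are exactly `min((lᵢ − ρ)/(1+α), (lᵢ − ρ)/(1−α))` and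
`max((lᵢ + ρ)/(1−α), (lᵢ + ρ)/(1+α))` (`min_div_eq_bySign` / `max_div_eq_bySign` below), so the printed interval contains

  `[ min((lᵢ − ρ)/(1+α), (lᵢ − ρ)/(1−α)) − E_F ,  max((lᵢ + ρ)/(1−α), (lᵢ + ρ)/(1+α)) + E_F ]`.      (A)

The engine derives (A) from Ostrowski's congruence theorem for `Xᵀ B X` (`θᵢ ∈ [1−α, 1+α]`) and Weyl's inequality
(`‖XᵀBX − Λ‖ ≤ α·Lmax + ‖X‖·δ ≤ ρ`).  THIS FILE proves that (A) IS an enclosure of `λ↓ᵢ(S)` (`S` = the exact block), by the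
same reduction as the lineage-C sibling `OstrowskiWeylRecord` (engine-3): the tree's typed KAHAN radius of lineage B
(`EigenRadius.abs_eigenvalues₀_sub_le_kahanRadius`: `|λ↓ᵢ(S) − λ↓ᵢ(diag L)| ≤ (δ + E_F √(1+α))/√(1−α)`, Stewart–Sun Thm IV.5.4,
whose hypotheses are precisely the three Frobenius sums the routine bounds) + the sibling's square-root-free majorant
`OstrowskiWeylRecord.kahanRadius_le` (imported) + two real-arithmetic lemmas that carry the factor `√(1+α)` of `ρ` through `1 ≤ √(1+α)`,
under `α ≤ 1/2` (enforced by the code) and the side condition `6 (δ + E_F) ≤ lᵢ + Lmax` — i.e. whenever the residuals are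
below the eigenvalue scale.  (A) is NOT an instance of the lineage-C theorem: `ρ_A = α·Lmax + √(1+α)·δ ≤ ρ_C = α·Lmax + (1 + α/2)·δ`,
so A's printed interval is the narrower one and needs its own arithmetic (`add_majorant_le_hi`, `lo_le_sub_majorant`).

SIDE-CONDITION CENSUS (engine-4 g4, hub, 2026-08-23T21:47Z, over every engine-4 out file of record
`engine/engine4/out/*.json`: 1³ β = 5, 6 main rows j184131/j184130, P/HF rows 5/2 … 6 j1867xx/j192407, twisted rows j202639,
2×1×1 ¼/½/¾ j191467/j199577/j197964+j198989 and their superseded cuts): 33 files, 245 certified blocks, 1,410 printed block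
eigenvalues, 0 failures of `6 (δ + E_F) ≤ lᵢ + Lmax`, worst margin `(lᵢ + Lmax)/(6 (δ + E_F)) = 6.9·10⁵` (a 2×1×1 β = ¼ block
level `1.7·10⁻⁶`), `max α = 3.2·10⁻⁹`; an engine citing this file re-checks the condition numerically for the levels it quotes.

* `add_majorant_le_hi`, `lo_le_sub_majorant` — the real arithmetic (with `s` standing for `√(1+α)`, hypothesis `1 ≤ s`);
* `eigenvalues₀_mem_Icc_record` — (A) encloses `λ↓ᵢ(S)` index-wise;
* `div_one_add_le_div_one_sub`, `div_one_sub_le_div_one_add`, `min_div_eq_bySign`, `max_div_eq_bySign` — the code's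
  `if lo_s ≥ 0 … else …` branches ARE the `min` / `max` of (A);
* `eigenvalues₀_mem_Icc_record_bySign` — (A) in the code's branch form.

So a lineage-A one-site / t211 eigenvalue row of record = this theorem (block) [∩ the Kato–Temple post-pass where the row says
so — typed: `Literature.Analysis.OperatorTheory` `kato_temple_enclosure`; an intersection of two enclosures is an enclosure]
+ the plaquette-label / character-cut operator-norm shift `τ` (Weyl, hypothesis) + the kept-set tail TAIL-A
(`KWeightTail.eigenvalues₀_mem_Icc`, typed) — modulo the routine's interval arithmetic for `α, δ, E_F`, exactly as for
lineages A-sntm (`RitzDeflationCertificate`), B (`EigenRadiusCertificate`) and C (`OstrowskiWeylRecord`).  Pure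
finite-dimensional linear algebra over an `RCLike` field; no lattice object, no number, no row, nothing about limits or a mass gap.
NOT here: the engine's own side-condition-free Ostrowski–Weyl derivation (it needs the float matrix `B` itself symmetric to
land on `± E_F` exactly; the reduction above does not), the IEEE-754 accumulation bounds that produce `α, δ, E_F` (hypotheses,
as in the three sibling files).

References: G. W. Stewart, J.-G. Sun, *Matrix Perturbation Theory* (1990), Thm IV.5.4 [cite: StewartSun1990, Thm IV.5.4];
R. A. Horn, C. R. Johnson, *Matrix Analysis*, 2nd ed. (2013), Thm 4.3.1 (Weyl), Thm 4.5.9 (Ostrowski) [cite: HornJohnson2013,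
Thm 4.5.9]; the cell's `engine/onesite/linalg.py` (docstring «CERTIFICATE», 2026-08-22) and FLOW-REFEREE.md FR-53/FR-60
(first lineage-A 1³ cells of record), FR-116 (t211 ¼), FR-126 (1³ plaquette CERT2 cells).
-/

noncomputable section

open Matrix

namespace Summit.Ventures.YMGap.FlowData

namespace OnesiteOstrowskiWeylRecord

/-! ### Real arithmetic: the Kahan-radius majorant sits inside interval (A) under the side condition -/

/-- **Upper arithmetic for interval (A).**  With `ρ = α Lmax + s δ` (`s` stands for `√(1+α)`, only `1 ≤ s` is used),
`0 ≤ α ≤ 1/2`, `δ, E_F ≥ 0` and the side condition `6 (δ + E_F) ≤ l + Lmax`: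
`l + (δ + E_F (1 + α/2))/(1 − α) ≤ (l + ρ)/(1 − α) + E_F`. [folklore] -/
theorem add_majorant_le_hi {α δ EF l Lmax s : ℝ} (hα : 0 ≤ α) (hα2 : α ≤ 1 / 2) (hδ : 0 ≤ δ) (hEF : 0 ≤ EF)
    (hs : 1 ≤ s) (hside : 6 * (δ + EF) ≤ l + Lmax) :
    l + (δ + EF * (1 + α / 2)) / (1 - α) ≤ (l + (α * Lmax + s * δ)) / (1 - α) + EF := by
  have h1 : 0 < 1 - α := by linarith
  rw [div_add' _ _ _ h1.ne', ← sub_nonneg]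
  have key : 0 ≤ ((l + (α * Lmax + s * δ)) + EF * (1 - α)) - (l * (1 - α) + (δ + EF * (1 + α / 2))) := by
    nlinarith [mul_nonneg hα (by linarith : (0:ℝ) ≤ l + Lmax - 6 * (δ + EF)), mul_nonneg hα hδ, mul_nonneg hα hEF,
      mul_nonneg (by linarith : (0:ℝ) ≤ s - 1) hδ]
  have e : (l + (α * Lmax + s * δ) + EF * (1 - α)) / (1 - α) - (l + (δ + EF * (1 + α / 2)) / (1 - α)) =
      (((l + (α * Lmax + s * δ)) + EF * (1 - α)) - (l * (1 - α) + (δ + EF * (1 + α / 2)))) / (1 - α) := by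
    field_simp
  rw [e]
  exact div_nonneg key h1.le

/-- **Lower arithmetic for interval (A).**  Same data: `(l − ρ)/(1 + α) − E_F ≤ l − (δ + E_F (1 + α/2))/(1 − α)`,
`ρ = α Lmax + s δ`, `1 ≤ s`. [folklore] -/
theorem lo_le_sub_majorant {α δ EF l Lmax s : ℝ} (hα : 0 ≤ α) (hα2 : α ≤ 1 / 2) (hδ : 0 ≤ δ) (hEF : 0 ≤ EF)
    (hs : 1 ≤ s) (hside : 6 * (δ + EF) ≤ l + Lmax) :
    (l - (α * Lmax + s * δ)) / (1 + α) - EF ≤ l - (δ + EF * (1 + α / 2)) / (1 - α) := by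
  have h1 : 0 < 1 - α := by linarith
  have h2 : 0 < 1 + α := by linarith
  rw [← sub_nonneg]
  have hG : (0:ℝ) ≤ l + Lmax - 6 * (δ + EF) := by linarith
  have hhalf : (0:ℝ) ≤ 1 / 2 - α := by linarith
  have key : 0 ≤ (l * (1 - α) - (δ + EF * (1 + α / 2))) * (1 + α)
      - ((l - (α * Lmax + s * δ)) - EF * (1 + α)) * (1 - α) := by
    nlinarith [mul_nonneg (mul_nonneg hα h1.le) hG, mul_nonneg (mul_nonneg h1.le (by linarith : (0:ℝ) ≤ s - 1)) hδ,
      mul_nonneg hα hδ, mul_nonneg hα hEF, mul_nonneg (mul_nonneg hα hδ) hhalf, mul_nonneg (mul_nonneg hα hEF) hhalf]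
  have e : l - (δ + EF * (1 + α / 2)) / (1 - α) - ((l - (α * Lmax + s * δ)) / (1 + α) - EF) =
      ((l * (1 - α) - (δ + EF * (1 + α / 2))) * (1 + α) - ((l - (α * Lmax + s * δ)) - EF * (1 + α)) * (1 - α)) /
        ((1 - α) * (1 + α)) := by
    field_simp
  rw [e]
  exact div_nonneg key (mul_pos h1 h2).le

/-! ### The enclosure of record -/

variable {𝕜 : Type*} [RCLike 𝕜] {m : Type*} [Fintype m] [DecidableEq m]

/-- **Lineage A-onesite / A-t211's block interval of record encloses index-wise.**  `S` Hermitian (the exact block),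
`A` any matrix (the assembled floating-point block), `X` any matrix and `L` real (computed eigenpairs) with
`Σ‖(S − A)ᵢⱼ‖² ≤ E_F²`, `Σ‖(A X − X·diag L)ᵢⱼ‖² ≤ δ²`, `Σ‖(Xᴴ X − 1)ᵢⱼ‖² ≤ α²`, `0 ≤ α ≤ 1/2`, `δ, E_F ≥ 0`; let
`lᵢ = λ↓ᵢ(diag L)` (the `i`-th largest computed eigenvalue) and assume the side condition `6 (δ + E_F) ≤ lᵢ + Lmax`
(`Lmax` any real; the program's `Lmax = max |L|`).  Then with `ρ = α·Lmax + √(1+α)·δ`: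
`min((lᵢ − ρ)/(1 + α), (lᵢ − ρ)/(1 − α)) − E_F ≤ λ↓ᵢ(S) ≤ max((lᵢ + ρ)/(1 − α), (lᵢ + ρ)/(1 + α)) + E_F`
— `linalg.certify` of engine-1 g5, used verbatim by `onesite3q`, `kit3qa`, `kit3qtw`, `t211_build`. [cite: StewartSun1990, Thm IV.5.4] -/
theorem eigenvalues₀_mem_Icc_record {S A X : Matrix m m 𝕜} (hS : S.IsHermitian) (L : m → ℝ)
    {EF δ α Lmax : ℝ} (hEF : 0 ≤ EF) (hδ : 0 ≤ δ) (hα : 0 ≤ α) (hα2 : α ≤ 1 / 2)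
    (h0 : ∑ i, ∑ j, ‖(S - A) i j‖ ^ 2 ≤ EF ^ 2)
    (h1 : ∑ i, ∑ j, ‖(A * X - X * diagonal (fun j => ((L j : ℝ) : 𝕜))) i j‖ ^ 2 ≤ δ ^ 2)
    (hG : ∑ i, ∑ j, ‖(Xᴴ * X - 1) i j‖ ^ 2 ≤ α ^ 2) (i : Fin (Fintype.card m))
    (hside : 6 * (δ + EF) ≤ (EigenRadius.isHermitian_diagonal_ofReal (𝕜 := 𝕜) L).eigenvalues₀ i + Lmax) :
    hS.eigenvalues₀ i ∈ Set.Icc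
      (min (((EigenRadius.isHermitian_diagonal_ofReal (𝕜 := 𝕜) L).eigenvalues₀ i - (α * Lmax + Real.sqrt (1 + α) * δ)) / (1 + α))
           (((EigenRadius.isHermitian_diagonal_ofReal (𝕜 := 𝕜) L).eigenvalues₀ i - (α * Lmax + Real.sqrt (1 + α) * δ)) / (1 - α)) - EF)
      (max (((EigenRadius.isHermitian_diagonal_ofReal (𝕜 := 𝕜) L).eigenvalues₀ i + (α * Lmax + Real.sqrt (1 + α) * δ)) / (1 - α))
           (((EigenRadius.isHermitian_diagonal_ofReal (𝕜 := 𝕜) L).eigenvalues₀ i + (α * Lmax + Real.sqrt (1 + α) * δ)) / (1 + α)) + EF) := by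
  set l := (EigenRadius.isHermitian_diagonal_ofReal (𝕜 := 𝕜) L).eigenvalues₀ i with hl_def
  set s := Real.sqrt (1 + α) with hs_def
  have hs : 1 ≤ s := Real.one_le_sqrt.mpr (by linarith)
  have hK := EigenRadius.abs_eigenvalues₀_sub_le_kahanRadius hS L hEF hδ hα (by linarith) h0 h1 hG i
  rw [← hl_def] at hK
  have hmaj := OstrowskiWeylRecord.kahanRadius_le hα (by linarith) hδ hEF
  have hK' : |hS.eigenvalues₀ i - l| ≤ (δ + EF * (1 + α / 2)) / (1 - α) := hK.trans hmaj
  rw [abs_sub_le_iff] at hK'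
  constructor
  · have hlo := lo_le_sub_majorant hα hα2 hδ hEF hs hside
    have hmin : min ((l - (α * Lmax + s * δ)) / (1 + α)) ((l - (α * Lmax + s * δ)) / (1 - α)) - EF ≤
        (l - (α * Lmax + s * δ)) / (1 + α) - EF := by
      linarith [min_le_left ((l - (α * Lmax + s * δ)) / (1 + α)) ((l - (α * Lmax + s * δ)) / (1 - α))]
    linarith [hK'.2]
  · have hhi := add_majorant_le_hi hα hα2 hδ hEF hs hside
    have hmax : (l + (α * Lmax + s * δ)) / (1 - α) + EF ≤
        max ((l + (α * Lmax + s * δ)) / (1 - α)) ((l + (α * Lmax + s * δ)) / (1 + α)) + EF := by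
      linarith [le_max_left ((l + (α * Lmax + s * δ)) / (1 - α)) ((l + (α * Lmax + s * δ)) / (1 + α))]
    linarith [hK'.1]

/-! ### The code's `if … ≥ 0` branches are the `min` / `max` of interval (A) -/

/-- For `0 ≤ α < 1` and `0 ≤ x`: `x/(1 + α) ≤ x/(1 − α)`. [folklore] -/
theorem div_one_add_le_div_one_sub {α x : ℝ} (hα : 0 ≤ α) (hα1 : α < 1) (hx : 0 ≤ x) :
    x / (1 + α) ≤ x / (1 - α) :=
  div_le_div_of_nonneg_left hx (by linarith) (by linarith)

/-- For `0 ≤ α < 1` and `x ≤ 0`: `x/(1 − α) ≤ x/(1 + α)`. [folklore] -/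
theorem div_one_sub_le_div_one_add {α x : ℝ} (hα : 0 ≤ α) (hα1 : α < 1) (hx : x ≤ 0) :
    x / (1 - α) ≤ x / (1 + α) := by
  have h1 : 0 < 1 - α := by linarith
  have h2 : 0 < 1 + α := by linarith
  rw [div_le_div_iff₀ h1 h2]
  nlinarith [mul_nonneg hα (neg_nonneg.mpr hx)]

/-- The lower branch of `linalg.certify` (`lo_s/(1+α) if lo_s ≥ 0 else lo_s/(1−α)`) is `min(lo_s/(1+α), lo_s/(1−α))`,
for `0 ≤ α < 1`. [folklore] -/
theorem min_div_eq_bySign {α x : ℝ} (hα : 0 ≤ α) (hα1 : α < 1) :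
    min (x / (1 + α)) (x / (1 - α)) = if 0 ≤ x then x / (1 + α) else x / (1 - α) := by
  split_ifs with hx
  · exact min_eq_left (div_one_add_le_div_one_sub hα hα1 hx)
  · exact min_eq_right (div_one_sub_le_div_one_add hα hα1 (le_of_lt (not_le.mp hx)))

/-- The upper branch of `linalg.certify` (`hi_s/(1−α) if hi_s ≥ 0 else hi_s/(1+α)`) is `max(hi_s/(1−α), hi_s/(1+α))`,
for `0 ≤ α < 1`. [folklore] -/
theorem max_div_eq_bySign {α x : ℝ} (hα : 0 ≤ α) (hα1 : α < 1) :
    max (x / (1 - α)) (x / (1 + α)) = if 0 ≤ x then x / (1 - α) else x / (1 + α) := by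
  split_ifs with hx
  · exact max_eq_left (div_one_add_le_div_one_sub hα hα1 hx)
  · exact max_eq_right (div_one_sub_le_div_one_add hα hα1 (le_of_lt (not_le.mp hx)))

/-- **Interval (A) in the code's branch form** (`linalg.certify`, lines `lo = lo_s/(1+alpha) if lo_s >= 0 else lo_s/(1-alpha)`,
`hi = hi_s/(1-alpha) if hi_s >= 0 else hi_s/(1+alpha)`, then `∓ E_fro`): same hypotheses as `eigenvalues₀_mem_Icc_record`.
[cite: StewartSun1990, Thm IV.5.4] -/
theorem eigenvalues₀_mem_Icc_record_bySign {S A X : Matrix m m 𝕜} (hS : S.IsHermitian) (L : m → ℝ)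
    {EF δ α Lmax : ℝ} (hEF : 0 ≤ EF) (hδ : 0 ≤ δ) (hα : 0 ≤ α) (hα2 : α ≤ 1 / 2)
    (h0 : ∑ i, ∑ j, ‖(S - A) i j‖ ^ 2 ≤ EF ^ 2)
    (h1 : ∑ i, ∑ j, ‖(A * X - X * diagonal (fun j => ((L j : ℝ) : 𝕜))) i j‖ ^ 2 ≤ δ ^ 2)
    (hG : ∑ i, ∑ j, ‖(Xᴴ * X - 1) i j‖ ^ 2 ≤ α ^ 2) (i : Fin (Fintype.card m))
    (hside : 6 * (δ + EF) ≤ (EigenRadius.isHermitian_diagonal_ofReal (𝕜 := 𝕜) L).eigenvalues₀ i + Lmax) :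
    hS.eigenvalues₀ i ∈ Set.Icc
      ((if 0 ≤ (EigenRadius.isHermitian_diagonal_ofReal (𝕜 := 𝕜) L).eigenvalues₀ i - (α * Lmax + Real.sqrt (1 + α) * δ)
        then ((EigenRadius.isHermitian_diagonal_ofReal (𝕜 := 𝕜) L).eigenvalues₀ i - (α * Lmax + Real.sqrt (1 + α) * δ)) / (1 + α)
        else ((EigenRadius.isHermitian_diagonal_ofReal (𝕜 := 𝕜) L).eigenvalues₀ i - (α * Lmax + Real.sqrt (1 + α) * δ)) / (1 - α)) - EF)
      ((if 0 ≤ (EigenRadius.isHermitian_diagonal_ofReal (𝕜 := 𝕜) L).eigenvalues₀ i + (α * Lmax + Real.sqrt (1 + α) * δ)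
        then ((EigenRadius.isHermitian_diagonal_ofReal (𝕜 := 𝕜) L).eigenvalues₀ i + (α * Lmax + Real.sqrt (1 + α) * δ)) / (1 - α)
        else ((EigenRadius.isHermitian_diagonal_ofReal (𝕜 := 𝕜) L).eigenvalues₀ i + (α * Lmax + Real.sqrt (1 + α) * δ)) / (1 + α)) + EF) := by
  have h := eigenvalues₀_mem_Icc_record hS L hEF hδ hα hα2 h0 h1 hG i hside
  rw [min_div_eq_bySign hα (by linarith), max_div_eq_bySign hα (by linarith)] at h
  exact h

end OnesiteOstrowskiWeylRecord

end Summit.Ventures.YMGap.FlowData
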